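import Mathlib.Analysis.Calculus.LocalExtr.Polynomial
import Mathlib.Analysis.Calculus.Deriv.MeanValue
import Mathlib.Topology.Algebra.Polynomial

/-!
# `MatrixDescartes` census — the END-KILL refinement of Rolle's theorem (kernel version)

HONEST FRAMING.  Object-search cell `pub-symmetroid`, route crux `Theses.LacunarySymmetroid.MatrixDescartes`
(ledger item stmt-ValiantsHypothesis-18050).  A kernel lemma about ONE arbitrary real polynomial — the counting
step «END KILLS ONLY» of the cell's window theorems (theory-2 g14 THEOREM N′ / WINDOW LEMMA and THEOREM NINE-END_TC,
theory-3's ladder notes): Rolle gives `#Z₊(h) ≤ #Z₊(h′) + 1`; if the constant coefficient of `h` and its FIRST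
non-zero higher coefficient have the SAME sign, the `+ 1` disappears, because `h` leaves `h(0) ≠ 0` moving AWAY from
`0` and must come back to `0` at its first positive root, which costs `h′` an extra positive root below it.

* `card_posRoots_le_card_posRoots_derivative_of_endKill` — for `h ∈ ℝ[X]`, `m ≥ 1`, `h.coeff j = 0` for
  `0 < j < m` and `0 < h.coeff 0 · h.coeff m`: the number of distinct positive roots of `h` is at most that of `h′`.
In the cell's fewnomial language (`f = x^{e₀}·h`, `x·f′ − e₀·f = x^{e₀+1}·h′`): if the two LOWEST coefficients of a
fewnomial have the same sign then `#Z₊(f) ≤ #Z₊(x f′ − e₀ f)` (no `+1`), the sharpening of the tree's twisted Rolle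
inequality `Census.card_posRoots_le_card_posRoots_twist_succ` used by every «end kill».
Nothing here bears on `ζ_sym`, `DoorA26` / `DoorA34`, the crux, or `VP ≠ VNP`.

[folklore] Rolle + one application of the mean value and intermediate value theorems.
-/

-- `Summit.ValiantsHypothesis.ValiantsHypothesis.…` repeats a component by the D-0017 layout
-- (single-conjunct summit), which the `dupNamespace` linter flags; the name is mandated.
set_option linter.dupNamespace false

namespace Summit.ValiantsHypothesis.ValiantsHypothesis.Theorems.LacunarySymmetroidMatrixDescartes.Census

open Polynomial Finset Set
open scoped BigOperators Polynomial

/-- Near `0⁺` a real polynomial with vanishing coefficients below index `k` and positive `k`-th coefficient is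
positive: `∃ ε > 0, ∀ x ∈ (0, ε), 0 < p(x)`. [folklore] -/
theorem eventually_pos_of_coeff_pos (p : ℝ[X]) (k : ℕ) (hlow : ∀ j, j < k → p.coeff j = 0)
    (hk : 0 < p.coeff k) : ∃ ε : ℝ, 0 < ε ∧ ∀ x : ℝ, 0 < x → x < ε → 0 < p.eval x := by
  -- factor `p = X^k * q` with `q(0) = p.coeff k > 0`
  obtain ⟨q, hq⟩ : X ^ k ∣ p := (Polynomial.X_pow_dvd_iff).mpr fun d hd => hlow d hd
  have hq0 : q.eval 0 = p.coeff k := by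
    rw [← coeff_zero_eq_eval_zero, hq, coeff_X_pow_mul', if_pos le_rfl, Nat.sub_self]
  have hqpos : 0 < q.eval 0 := by rw [hq0]; exact hk
  -- continuity of `q` at `0`
  have hcont : ContinuousAt (fun x => q.eval x) 0 := q.continuousAt
  obtain ⟨ε, hε, hball⟩ := Metric.continuousAt_iff.mp hcont (q.eval 0 / 2) (by linarith)
  refine ⟨ε, hε, fun x hx0 hxε => ?_⟩
  have hdist : dist x 0 < ε := by rw [dist_zero_right, Real.norm_eq_abs, abs_of_pos hx0]; exact hxε
  have hqx := hball hdist
  rw [Real.dist_eq] at hqx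
  have hqx' : q.eval 0 / 2 < q.eval x := by
    have := (abs_lt.mp hqx).1; linarith
  rw [hq, eval_mul, eval_pow, eval_X]
  exact mul_pos (pow_pos hx0 k) (by linarith)

/-- **END-KILL LEMMA (positive normalisation).**  `h.coeff 0 > 0`, `h.coeff j = 0` for `0 < j < m`, `h.coeff m > 0`
(`m ≥ 1`) ⇒ `#Z₊^{distinct}(h) ≤ #Z₊^{distinct}(h′)`. [folklore] -/
theorem card_posRoots_le_card_posRoots_derivative_of_endKill_pos (h : ℝ[X]) {m : ℕ} (hm : 1 ≤ m)
    (h0 : 0 < h.coeff 0) (hgap : ∀ j, 1 ≤ j → j < m → h.coeff j = 0) (hcm : 0 < h.coeff m) :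
    (h.roots.toFinset.filter (fun x => 0 < x)).card ≤
      (h.derivative.roots.toFinset.filter (fun x => 0 < x)).card := by
  have hne : h ≠ 0 := by intro h0'; rw [h0', coeff_zero] at h0; exact lt_irrefl 0 h0
  -- `h′` has vanishing coefficients below `m − 1` and `(h′).coeff (m−1) = m · h.coeff m > 0`
  have hd_low : ∀ j, j < m - 1 → h.derivative.coeff j = 0 := by
    intro j hj
    rw [coeff_derivative, hgap (j + 1) (by omega) (by omega), zero_mul]
  have hd_m : 0 < h.derivative.coeff (m - 1) := by
    rw [coeff_derivative, show m - 1 + 1 = m by omega]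
    have : (0 : ℝ) < (m - 1 : ℕ) + 1 := by positivity
    exact mul_pos hcm this
  have hdne : h.derivative ≠ 0 := by
    intro h0'; rw [h0', coeff_zero] at hd_m; exact lt_irrefl 0 hd_m
  obtain ⟨ε, hε, hpos⟩ := eventually_pos_of_coeff_pos h.derivative (m - 1) hd_low hd_m
  set s := h.roots.toFinset.filter (fun x => 0 < x) with hs
  set t := h.derivative.roots.toFinset.filter (fun x => 0 < x) with ht
  have hmem_s : ∀ x, x ∈ s ↔ h.IsRoot x ∧ 0 < x := by
    intro x; rw [hs, Finset.mem_filter, Multiset.mem_toFinset, mem_roots hne]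
  have hmem_t : ∀ x, x ∈ t ↔ h.derivative.IsRoot x ∧ 0 < x := by
    intro x; rw [ht, Finset.mem_filter, Multiset.mem_toFinset, mem_roots hdne]
  have h0s : (0 : ℝ) ∉ s := by rw [hmem_s]; exact fun hh => lt_irrefl 0 hh.2
  -- interleave `insert 0 s` with `t`
  have key : (insert (0 : ℝ) s).card ≤ (t \ insert (0 : ℝ) s).card + 1 := by
    refine Finset.card_le_sdiff_of_interleaved fun x hx y hy hxy _ => ?_
    rw [Finset.mem_insert] at hx hy
    have hyroot : h.IsRoot y ∧ 0 < y := by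
      rcases hy with rfl | hy
      · rcases hx with rfl | hx
        · exact absurd hxy (lt_irrefl _)
        · exact absurd ((hmem_s x).mp hx).2 (by linarith)
      · exact (hmem_s y).mp hy
    rcases hx with rfl | hx
    · -- the END KILL: a root of `h′` in `(0, y)`
      have hy0 : (0 : ℝ) < y := hyroot.2
      -- mean value theorem on `[0, y]`: some `ξ` with `h′(ξ) = (h y − h 0)/y < 0`
      obtain ⟨ξ, hξ, hξslope⟩ := exists_deriv_eq_slope (fun x => h.eval x) hy0 h.continuousOn
        (h.differentiable.differentiableOn)
      have hξneg : h.derivative.eval ξ < 0 := by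
        rw [← Polynomial.deriv, hξslope, sub_zero]
        have hhy : h.eval y = 0 := hyroot.1
        have hh0 : h.eval 0 = h.coeff 0 := by rw [coeff_zero_eq_eval_zero]
        rw [hhy, hh0]
        exact div_neg_of_neg_of_pos (by linarith) hy0
      -- a point `x₀ ∈ (0, ξ)` with `h′(x₀) > 0`
      set x₀ : ℝ := min (ε / 2) (ξ / 2) with hx₀
      have hx₀pos : 0 < x₀ := lt_min (by linarith) (by linarith [hξ.1])
      have hx₀ε : x₀ < ε := lt_of_le_of_lt (min_le_left _ _) (by linarith)
      have hx₀ξ : x₀ < ξ := lt_of_le_of_lt (min_le_right _ _) (by linarith [hξ.1])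
      have hx₀val : 0 < h.derivative.eval x₀ := hpos x₀ hx₀pos hx₀ε
      -- intermediate value on `[x₀, ξ]`
      have hcont : ContinuousOn (fun x => h.derivative.eval x) (Icc x₀ ξ) := h.derivative.continuousOn
      have hmem : (0 : ℝ) ∈ Ioo (h.derivative.eval ξ) (h.derivative.eval x₀) := ⟨hξneg, hx₀val⟩
      obtain ⟨z, hz, hzval⟩ := intermediate_value_Ioo' hx₀ξ.le hcont hmem
      refine ⟨z, (hmem_t z).mpr ⟨hzval, lt_trans hx₀pos hz.1⟩, lt_trans hx₀pos hz.1, ?_⟩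
      exact lt_trans hz.2 hξ.2
    · -- ordinary Rolle between two positive roots
      have hxroot := (hmem_s x).mp hx
      obtain ⟨z, hz1, hz2⟩ := exists_deriv_eq_zero hxy h.continuousOn (hxroot.1.trans hyroot.1.symm)
      refine ⟨z, (hmem_t z).mpr ⟨?_, lt_trans hxroot.2 hz1.1⟩, hz1.1, hz1.2⟩
      rw [IsRoot, ← Polynomial.deriv]; exact hz2
  rw [Finset.card_insert_of_notMem h0s] at key
  have : (t \ insert (0 : ℝ) s).card ≤ t.card := Finset.card_le_card Finset.sdiff_subset
  omega

/-- **END-KILL LEMMA.**  For a real polynomial `h` and `m ≥ 1` with `h.coeff j = 0` for `0 < j < m` and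
`h.coeff 0 · h.coeff m > 0` (the constant coefficient and the first non-zero higher coefficient have the same sign),
the number of distinct positive roots of `h` is at most the number of distinct positive roots of `h′` — Rolle's
bound without the `+ 1`.  (theory-2 g14's «END KILLS» step: `x^{−e₀}f` leaves `c₀` moving away from `0`, so `f′`-type
derivatives gain a critical point before the first positive root.) [folklore] -/
theorem card_posRoots_le_card_posRoots_derivative_of_endKill (h : ℝ[X]) {m : ℕ} (hm : 1 ≤ m)
    (hgap : ∀ j, 1 ≤ j → j < m → h.coeff j = 0) (hsame : 0 < h.coeff 0 * h.coeff m) :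
    (h.roots.toFinset.filter (fun x => 0 < x)).card ≤
      (h.derivative.roots.toFinset.filter (fun x => 0 < x)).card := by
  rcases lt_or_gt_of_ne (show h.coeff 0 ≠ 0 from fun h0 => by rw [h0, zero_mul] at hsame; exact lt_irrefl 0 hsame)
    with hneg | hposc
  · -- both negative: pass to `−h`
    have hcm : h.coeff m < 0 := by
      by_contra hc; rw [not_lt] at hc
      have := mul_nonpos_of_nonpos_of_nonneg hneg.le hc
      linarith
    have h1 := card_posRoots_le_card_posRoots_derivative_of_endKill_pos (-h) hm
      (by rw [coeff_neg]; linarith) (fun j hj1 hj2 => by rw [coeff_neg, hgap j hj1 hj2, neg_zero])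
      (by rw [coeff_neg]; linarith)
    rwa [roots_neg, derivative_neg, roots_neg] at h1
  · have hcm : 0 < h.coeff m := by
      by_contra hc; rw [not_lt] at hc
      have := mul_nonpos_of_nonneg_of_nonpos hposc.le hc
      linarith
    exact card_posRoots_le_card_posRoots_derivative_of_endKill_pos h hm hposc hgap hcm

/-- Positive roots are unchanged by a monomial factor: `#Z₊(X^k · p) = #Z₊(p)`. [folklore] -/
theorem card_posRoots_X_pow_mul (p : ℝ[X]) (k : ℕ) :
    ((X ^ k * p).roots.toFinset.filter (fun x => 0 < x)).card =
      (p.roots.toFinset.filter (fun x => 0 < x)).card := by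
  rcases eq_or_ne p 0 with rfl | hp
  · simp
  have hne : (X : ℝ[X]) ^ k * p ≠ 0 := mul_ne_zero (pow_ne_zero _ X_ne_zero) hp
  congr 1
  ext x
  simp only [Finset.mem_filter, Multiset.mem_toFinset, mem_roots hne, mem_roots hp, IsRoot.def, eval_mul,
    eval_pow, eval_X, mul_eq_zero, pow_eq_zero_iff', ne_eq]
  constructor
  · rintro ⟨h | h, hx⟩
    · exact absurd h.1 hx.ne'
    · exact ⟨h, hx⟩
  · rintro ⟨h, hx⟩; exact ⟨Or.inr h, hx⟩

/-- **END-KILL LEMMA, twist form** (the cell's usage).  Let `f ∈ ℝ[X]` have lowest exponent `k`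
(`f.coeff j = 0` for `j < k`), next possible exponent `k + m` (`f.coeff j = 0` for `k < j < k + m`, `m ≥ 1`) and
`f.coeff k · f.coeff (k+m) > 0` (the two LOWEST coefficients have the same sign).  Then the Euler twist at the lowest
exponent loses NO positive root: `#Z₊(f) ≤ #Z₊(X·f′ − k·f)` (compare the tree's `card_posRoots_le_card_posRoots_twist_succ`,
which has `+ 1` for an arbitrary weight). [folklore] -/
theorem card_posRoots_le_card_posRoots_twist_of_endKill (f : ℝ[X]) {k m : ℕ} (hm : 1 ≤ m)
    (hlow : ∀ j, j < k → f.coeff j = 0) (hgap : ∀ j, k < j → j < k + m → f.coeff j = 0)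
    (hsame : 0 < f.coeff k * f.coeff (k + m)) :
    (f.roots.toFinset.filter (fun x => 0 < x)).card ≤
      ((X * derivative f - C (k : ℝ) * f).roots.toFinset.filter (fun x => 0 < x)).card := by
  obtain ⟨h, hf⟩ : X ^ k ∣ f := (Polynomial.X_pow_dvd_iff).mpr fun d hd => hlow d hd
  have hcoeff : ∀ j, h.coeff j = f.coeff (j + k) := by
    intro j; rw [hf, coeff_X_pow_mul]
  -- the twist of `X^k h` at weight `k` is `X^(k+1) h′`
  have htwist : X * derivative f - C (k : ℝ) * f = X ^ (k + 1) * derivative h := by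
    rw [hf, derivative_mul, derivative_X_pow, map_natCast]
    rcases k with _ | k
    · simp
    · rw [show k + 1 - 1 = k from rfl, pow_succ, pow_succ]; push_cast; ring
  rw [htwist, card_posRoots_X_pow_mul, hf, card_posRoots_X_pow_mul]
  refine card_posRoots_le_card_posRoots_derivative_of_endKill h hm (fun j hj1 hj2 => ?_) ?_
  · rw [hcoeff]; exact hgap (j + k) (by omega) (by omega)
  · rw [hcoeff, hcoeff, zero_add, show m + k = k + m from Nat.add_comm m k]; exact hsame

/-- The adjacent-coefficient case `m = 1` of the END-KILL lemma (no gap hypothesis to check): if the two LOWEST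
coefficients of `h` have the same sign, `h.coeff 0 · h.coeff 1 > 0`, then `#Z₊(h) ≤ #Z₊(h′)` — Rolle's bound without
the `+ 1`.  This is the form the window replays use most often (consecutive exponents). [folklore] -/
theorem card_posRoots_le_card_posRoots_derivative_of_coeff_zero_mul_coeff_one_pos (h : ℝ[X])
    (hsame : 0 < h.coeff 0 * h.coeff 1) :
    (h.roots.toFinset.filter (fun x => 0 < x)).card ≤
      (h.derivative.roots.toFinset.filter (fun x => 0 < x)).card :=
  card_posRoots_le_card_posRoots_derivative_of_endKill h le_rfl (fun j hj1 hj2 => by omega) hsame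

end Summit.ValiantsHypothesis.ValiantsHypothesis.Theorems.LacunarySymmetroidMatrixDescartes.Census
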